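import Summits.Ventures.QEC.Census.BB.BB288.CoverL21Q13Data
import HarnessLib

set_option Elab.async false

/-!
# `[[288,12,18]]` cover certificate — level-2→1 problem 13: scan CHUNKS 0–0 of 41 (chunk `i` = the selections whose
first row is `i`, budget 4 over the later rows; ≈ 102091 selections in this file), plain `decide`.
-/

namespace Summit.Ventures.QEC.Census.BB288Cover

open Summit.Ventures.QEC.Census

/-- Chunk 0 of problem 13 (102091 selections; first selected row = 0). -/
theorem q13_chunk0 : scan (bzLeaf 5 q13.allow) ((rowPos q13Gc 0).drop (0 + 1)) 4
    (2 ^ 41 ^^^ ((rowPos q13Gc 0)[0]'(by decide)).1) (q13c0 ^^^ ((rowPos q13Gc 0)[0]'(by decide)).2) = true := by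
  decide +kernel

end Summit.Ventures.QEC.Census.BB288Cover
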